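import Literature.NumberTheory.Automorphic.LevelActionCoefficientChange
import Literature.Algebra.Homology.GroupCohomologySemilinear
import HarnessLib

/-!
# Semilinear push-forward of level-action cohomology (change of coefficient RING)

Topic `NumberTheory/Automorphic`; namespace `Literature.NumberTheory.Automorphic.LevelAction`;
definitions with bodies and theorems.  `LevelActionCoefficientChange` pushes the sections
`M(U, τ)` and the cohomology `H^i(U, τ)` forward along an equivariant LINEAR map of coefficients;
here the same along a `σ`-SEMILINEAR equivariant map `φ : V → V'` between a `Δ`-module `V` over `R`
and a `Δ`-module `V'` over `R'` (`σ : R → R'`), e.g. the reduction `⨂_τ Sym(𝒪²) → ⨂_τ Sym((𝒪/ϖ^r)²)`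
(`σ = 𝒪 → 𝒪/ϖ^r`) or the inclusion `⨂_τ Sym(𝒪²) → ⨂_τ Sym(E²)` (`σ = 𝒪 ⊆ E`) of Hida theory
([Hida1994AIF, §1–§2]; [KhareThorne2017, §6.3–6.4]):

* `sectionsSemimap φ hφ : M(U, τ) →ₛₗ[σ] M(U, τ')`, `f ↦ φ ∘ f`, equivariant for left translation
  (`sectionsSemimap_rep`) and for the Hecke operators (`sectionsSemimap_heckeOp`);
* **`cohomologySemimap φ hφ i : H^i(U, τ) →ₛₗ[σ] H^i(U, τ')`** (the tree's semilinear
  functoriality of group cohomology `GroupCohomologySemilinear.semimap`), **commuting with the Hecke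
  operators** (`cohomologySemimap_heckeCohomology`) and hence mapping `[U α U]`-ordinary parts to
  ordinary parts (`mapsTo_cohomologySemimap_ordinaryPart`).

## References

* H. Hida, Ann. Inst. Fourier 44 (1994), §1–§2 (held). [Hida1994AIF]
* C. Khare, J. A. Thorne, Amer. J. Math. 139 (2017), §6.3–6.4 (arXiv:1409.7007, held). [KhareThorne2017]
* K. S. Brown, *Cohomology of Groups*, GTM 87 (1982), III.1 Example 3. [Brown1982CohomologyGroups]
-/

noncomputable section

open CategoryTheory Literature.Algebra.Homology

universe u

namespace Literature.NumberTheory.Automorphic.LevelAction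

variable {R R' : Type u} [CommRing R] [CommRing R'] {σ : R →+* R'} {Γ 𝒢 : Type u} [Group Γ] [Group 𝒢]
  (ι : Γ →* 𝒢) (Δ : Submonoid 𝒢) {V V' : Type u} [AddCommGroup V] [Module R V] [AddCommGroup V']
  [Module R' V'] (τ : Δ →* Module.End R V) (τ' : Δ →* Module.End R' V') (U : Subgroup 𝒢)
  (hU : U.toSubmonoid ≤ Δ) (φ : V →ₛₗ[σ] V') (hφ : ∀ (δ : Δ) (v : V), φ (τ δ v) = τ' δ (φ v))

/-! ### Sections -/

include hφ in
/-- Post-composition with `φ` commutes with `act` (at elements of `Δ`). [folklore] -/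
theorem comp_act_of_mem {x : 𝒢} (hx : x ∈ Δ) (f : 𝒢 → V) :
    (fun g => φ (act Δ (fnAction Δ τ) x f g)) = act Δ (fnAction Δ τ') x (fun g => φ (f g)) := by
  rw [act_of_mem hx, act_of_mem hx]
  funext g
  rw [fnAction_apply, fnAction_apply, hφ]

include hU hφ in
/-- `φ ∘ f` is a section when `f` is. [folklore] -/
theorem comp_mem_sections {f : 𝒢 → V} (hf : f ∈ sections Δ τ U) : (fun g => φ (f g)) ∈ sections Δ τ' U := by
  rw [mem_sections_iff hU] at hf ⊢
  intro g u hu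
  rw [← hφ, hf g u hu]

/-- **`M(U, τ) →ₛₗ[σ] M(U, τ')`, `f ↦ φ ∘ f`.** [cite: Hida1994AIF, §1] -/
def sectionsSemimap : sections Δ τ U →ₛₗ[σ] sections Δ τ' U where
  toFun f := ⟨fun g => φ (f.1 g), comp_mem_sections Δ τ τ' U hU φ hφ f.2⟩
  map_add' f f' := Subtype.ext (funext fun g => by
    change φ (f.1 g + f'.1 g) = φ (f.1 g) + φ (f'.1 g)
    rw [map_add])
  map_smul' c f := Subtype.ext (funext fun g => by
    change φ (c • f.1 g) = σ c • φ (f.1 g)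
    rw [map_smulₛₗ])

/-- Unfolding `sectionsSemimap`. [folklore] -/
@[simp]
theorem coe_sectionsSemimap_apply (f : sections Δ τ U) (g : 𝒢) :
    (sectionsSemimap Δ τ τ' U hU φ hφ f : 𝒢 → V') g = φ (f.1 g) :=
  rfl

/-- `sectionsSemimap` is equivariant for left translation. [folklore] -/
theorem sectionsSemimap_rep (γ : Γ) (f : sections Δ τ U) :
    sectionsSemimap Δ τ τ' U hU φ hφ (rep ι Δ τ U γ f) = rep ι Δ τ' U γ (sectionsSemimap Δ τ τ' U hU φ hφ f) :=
  Subtype.ext rfl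

include hU hφ in
/-- **`φ ∘ [U β U] f = [U β U] (φ ∘ f)`** for `β ∈ Δ` (the representatives of `U β U / U` lie in `Δ`).
[folklore] -/
theorem comp_heckeOp {β : 𝒢} (hβ : β ∈ Δ) (f : 𝒢 → V) :
    (fun g => φ (heckeOp Δ (fnAction Δ τ) U β f g)) = heckeOp Δ (fnAction Δ τ') U β (fun g => φ (f g)) := by
  classical
  by_cases h : (ArithmeticQuotient.doubleCosetQuot U β).Finite
  · rw [heckeOp_eq_sum h, heckeOp_eq_sum h]
    funext g
    rw [LinearMap.sum_apply, LinearMap.sum_apply, Finset.sum_apply, Finset.sum_apply, map_sum]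
    refine Finset.sum_congr rfl fun d hd => ?_
    rw [Set.Finite.mem_toFinset] at hd
    exact congr_fun (comp_act_of_mem Δ τ τ' φ hφ (out_mem_of_mem_doubleCosetQuot hU hβ hd) f) g
  · rw [heckeOp_eq_zero_of_infinite h, heckeOp_eq_zero_of_infinite h]
    funext g
    simp

/-- **`sectionsSemimap` commutes with the Hecke endomorphisms of the sections.** [folklore] -/
theorem sectionsSemimap_heckeRepHom {β : 𝒢} (hβ : β ∈ Δ) (f : sections Δ τ U) :
    sectionsSemimap Δ τ τ' U hU φ hφ ((heckeRepHom ι Δ τ U hU hβ).hom f) =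
      (heckeRepHom ι Δ τ' U hU hβ).hom (sectionsSemimap Δ τ τ' U hU φ hφ f) :=
  Subtype.ext (comp_heckeOp Δ τ τ' U hU φ hφ hβ f.1)

/-! ### Cohomology -/

/-- **`H^i(U, τ) →ₛₗ[σ] H^i(U, τ')` along `φ`** (semilinear functoriality of group cohomology).
[cite: Hida1994AIF, §1] [cite: Brown1982CohomologyGroups, III.1 Example 3] -/
def cohomologySemimap (i : ℕ) : cohomology ι Δ τ U i →ₛₗ[σ] cohomology ι Δ τ' U i :=
  semimap (A := Rep.of (rep ι Δ τ U)) (B := Rep.of (rep ι Δ τ' U))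
    (sectionsSemimap Δ τ τ' U hU φ hφ) (fun γ f => sectionsSemimap_rep ι Δ τ τ' U hU φ hφ γ f) i

/-- **`cohomologySemimap` commutes with the Hecke operators `[U β U]`, `β ∈ Δ`.**
[cite: KhareThorne2017, §6.4] -/
theorem cohomologySemimap_heckeCohomology {β : 𝒢} (hβ : β ∈ Δ) (i : ℕ) (x : cohomology ι Δ τ U i) :
    cohomologySemimap ι Δ τ τ' U hU φ hφ i (heckeCohomology ι Δ τ U hU hβ i x) =
      heckeCohomology ι Δ τ' U hU hβ i (cohomologySemimap ι Δ τ τ' U hU φ hφ i x) :=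
  semimap_map_endo (A := Rep.of (rep ι Δ τ U)) (B := Rep.of (rep ι Δ τ' U)) _ _
    (heckeRepHom ι Δ τ U hU hβ) (heckeRepHom ι Δ τ' U hU hβ)
    (fun f => sectionsSemimap_heckeRepHom ι Δ τ τ' U hU φ hφ hβ f) i x

/-- As a composition of maps. [folklore] -/
theorem cohomologySemimap_comp_heckeCohomology {β : 𝒢} (hβ : β ∈ Δ) (i : ℕ) :
    (cohomologySemimap ι Δ τ τ' U hU φ hφ i).toAddMonoidHom.comp (heckeCohomology ι Δ τ U hU hβ i).toAddMonoidHom =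
      (heckeCohomology ι Δ τ' U hU hβ i).toAddMonoidHom.comp (cohomologySemimap ι Δ τ τ' U hU φ hφ i).toAddMonoidHom :=
  AddMonoidHom.ext fun x => cohomologySemimap_heckeCohomology ι Δ τ τ' U hU φ hφ hβ i x

/-- `cohomologySemimap` commutes with the powers of the Hecke operators. [folklore] -/
theorem cohomologySemimap_heckeCohomology_pow {β : 𝒢} (hβ : β ∈ Δ) (i n : ℕ) (x : cohomology ι Δ τ U i) :
    cohomologySemimap ι Δ τ τ' U hU φ hφ i ((heckeCohomology ι Δ τ U hU hβ i ^ n) x) =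
      (heckeCohomology ι Δ τ' U hU hβ i ^ n) (cohomologySemimap ι Δ τ τ' U hU φ hφ i x) := by
  induction n generalizing x with
  | zero => rfl
  | succ n ih =>
    rw [pow_succ, pow_succ, Module.End.mul_apply, Module.End.mul_apply, ih, cohomologySemimap_heckeCohomology]

/-- **`cohomologySemimap` maps the `[U β U]`-ordinary part into the `[U β U]`-ordinary part.**
[folklore] -/
theorem mapsTo_cohomologySemimap_ordinaryPart {β : 𝒢} (hβ : β ∈ Δ) (i : ℕ) :
    Set.MapsTo (cohomologySemimap ι Δ τ τ' U hU φ hφ i)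
      (⨅ n : ℕ, LinearMap.range (heckeCohomology ι Δ τ U hU hβ i ^ n) : Submodule R _)
      (⨅ n : ℕ, LinearMap.range (heckeCohomology ι Δ τ' U hU hβ i ^ n) : Submodule R' _) := by
  intro x hx
  simp only [SetLike.mem_coe, Submodule.mem_iInf, LinearMap.mem_range] at hx ⊢
  intro n
  obtain ⟨y, hy⟩ := hx n
  exact ⟨cohomologySemimap ι Δ τ τ' U hU φ hφ i y, by
    rw [← cohomologySemimap_heckeCohomology_pow, hy]⟩

end Literature.NumberTheory.Automorphic.LevelAction
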